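import Mathlib
import HarnessLib
import HarnessLib.Audit.Tags

/-!
# HodgeLocusCensusLengthFiltration — 'length = sum of the Hilbert function of the tangent cone'

HONEST FRAMING (verbatim, pub-hlocus cell): certified instances and evidence bearing on the general
Hodge conjecture; no claim.

DICTIONARY (cell files `CENSUS-SUMMARY.md` §2 rows O6–O8; engine A `tilt.py` prints
'HS = [1, 2, …, L, L]' = the partial sums of the Hilbert function `h(0), h(1), …` of the tangent cone of
the slice germ and reads off 'FAT POINT of length `L`' when `h(N) = 0`; engine B `fmexact` likewise).
With `S = R ⧸ I` the slice germ and `𝔪` the maximal ideal, `h(i) = length (𝔪^i S ⧸ 𝔪^(i+1) S)` (a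
vector space over the residue field; its `R`-length is its dimension) and `h(N) = 0` ⇒ `𝔪^N S = 0`
(Nakayama; `HodgeLocusCensusNakayamaCertificate`).  This module checks the remaining bookkeeping:
the LENGTH of `S` is the SUM `h(0) + ⋯ + h(N-1)`.

What the kernel checks (Mathlib only, no definitions; any ring `R`, any module `M`):
* `length_eq_sum_add` — for a descending chain of submodules `F 0 ≥ F 1 ≥ ⋯`:
  `length (F 0) = Σ_{i<n} length (F i ⧸ F (i+1)) + length (F n)` (additivity of length on the exact
  sequences `0 → F (i+1) → F i → F i ⧸ F (i+1) → 0`, Mathlib `Module.length_eq_add_of_exact`).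
* `length_eq_sum_of_filtration` — if moreover `F 0 = ⊤` and `F N = ⊥` then
  `length M = Σ_{i<N} length (F i ⧸ F (i+1))`.
* `length_eq_sum_adic` — the case `F i = 𝔪^i • M` with `𝔪^N • M = 0`: `length M = Σ_{i<N} h(i)`.
(The subquotient `F i ⧸ F (i+1)` is written `↥(F i) ⧸ (F (i+1)).comap (F i).subtype`.)
NOT formalised: the computation of the `h(i)` by the engines, and all Hodge theory.
-/

namespace Summit.HodgeConjecture.HodgeConjecture.HodgeLocus.Census

open scoped BigOperators

variable {R M : Type*} [CommRing R] [AddCommGroup M] [Module R M]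

/-- Additivity of length along a descending chain of submodules. -/
theorem length_eq_sum_add (F : ℕ → Submodule R M) (hF : ∀ i, F (i + 1) ≤ F i) (n : ℕ) :
    Module.length R ↥(F 0) =
      (∑ i ∈ Finset.range n, Module.length R (↥(F i) ⧸ (F (i + 1)).comap (F i).subtype)) +
        Module.length R ↥(F n) := by
  induction n with
  | zero => simp
  | succ n ih =>
    rw [Finset.sum_range_succ, ih, add_assoc]
    congr 1
    set K : Submodule R ↥(F n) := (F (n + 1)).comap (F n).subtype with hK
    have hadd : Module.length R ↥(F n) = Module.length R ↥K + Module.length R (↥(F n) ⧸ K) :=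
      Module.length_eq_add_of_exact K.subtype K.mkQ (Submodule.injective_subtype K)
        (Submodule.mkQ_surjective K) (LinearMap.exact_subtype_mkQ K)
    have hKF : Module.length R ↥K = Module.length R ↥(F (n + 1)) :=
      (Submodule.comapSubtypeEquivOfLe (hF n)).length_eq
    rw [hadd, hKF, add_comm]

/-- **Length of a module with a finite descending filtration** from `⊤` to `⊥` = the sum of the
lengths of the graded pieces. -/
theorem length_eq_sum_of_filtration (F : ℕ → Submodule R M) (hF : ∀ i, F (i + 1) ≤ F i)
    (h0 : F 0 = ⊤) {N : ℕ} (hN : F N = ⊥) :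
    Module.length R M =
      ∑ i ∈ Finset.range N, Module.length R (↥(F i) ⧸ (F (i + 1)).comap (F i).subtype) := by
  have h := length_eq_sum_add F hF N
  have htop : Module.length R ↥(F 0) = Module.length R M := by rw [h0]; exact Module.length_top
  have hbot : Module.length R ↥(F N) = 0 := by rw [hN]; exact Module.length_bot
  rw [htop, hbot, add_zero] at h
  exact h

/-- **Length = sum of the Hilbert function of the tangent cone.**  For an ideal `𝔪` with
`𝔪^N • M = 0`: `length M = Σ_{i<N} length (𝔪^i M ⧸ 𝔪^(i+1) M)`. -/
theorem length_eq_sum_adic (𝔪 : Ideal R) {N : ℕ} (hN : (𝔪 ^ N • ⊤ : Submodule R M) = ⊥) :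
    Module.length R M =
      ∑ i ∈ Finset.range N, Module.length R
        (↥(𝔪 ^ i • ⊤ : Submodule R M) ⧸
          (𝔪 ^ (i + 1) • ⊤ : Submodule R M).comap (𝔪 ^ i • ⊤ : Submodule R M).subtype) := by
  refine length_eq_sum_of_filtration (fun i => 𝔪 ^ i • ⊤) (fun i => ?_) (by simp) hN
  exact Submodule.smul_mono_left (Ideal.pow_le_pow_right (Nat.le_succ i))

end Summit.HodgeConjecture.HodgeConjecture.HodgeLocus.Census
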